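/-
b2b-lace packet, LEAN TYPING SEAT 2 gen 15 (unit `b2b-lace-lean2-g15`).  (S2b)-IMPR, the H₄ leaf (L6) AT THE INTEGRAL LEVEL in the
App.-C-consistent form (DIVERGENCE D75; REFEREE v68 R385 / ORDERS (1): the corrected improvement map, `NobleLaplacianBounds.abs_H4_le`
in the place of `F3Bounds.boundH4`; NEW module, `F3Bounds` untouched, owner lean2).  d-generic; no numeral, no dimension, no named fact.
-/
import Literature.Probability.FitznerVanDerHofstad2017.F3BoundsD75
import Literature.Probability.FitznerVanDerHofstad2017.SrwIntegralBounds
import HarnessLib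

/-!
# Literature.Probability.FitznerVanDerHofstad2017.NobleH4StepD75 — Step 4 of [NoBLE17] §3.3.5 integrated against the `(l,x)`-kernel

[NoBLE17] = Fitzner–van der Hofstad, *Generalized approach to the non-backtracking lace expansion*, PTRF 169 (2017) 1041–1119.

The Step-4 piece of the weighted diagram is ((3.58), TeX l.2075)
`ℋ^{n,l}_{4,z}(x) = ∫_{[−π,π]^d} Ĥ₄(k) D̂(k)^l Ĝ_z(k)ⁿ D̂^{(x)}(k) dk/(2π)^d`, `Ĥ₄ = −ΔR̂_Φ/(1−F̂) − (ΔR̂_F/(1−F̂))·Ĝ` ((3.55);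
kernel `LapAtoms.H4`).  The print bounds it by (3.78) = `F3Bounds.boundH4` (`K̲ (β_{ΔR,Φ} K_{n,l} + β_{|ΔR,F|} Γ₂′ K_{n+1,l})`); the
tree's pointwise Step 4 is `NobleLaplacianBounds.LapAtoms.KeyBounds.abs_H4_le` (`|Ĥ₄| ≤ K̲ Ĉ (β_{ΔR,Φ} + β_{|ΔR,F|} Γ₂′ Ĉ)`, one power of
`Ĉ = 1/[1 − D̂]` more than the printed display — DIVERGENCE D75), and with the `n` two-point lines (`|Ĝ| ≤ Γ₂′ Ĉ`, (3.47)) the pointwise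
majorant is `F3BoundsD75`'s `LapAtoms.KeyBounds.pow_abs_G_mul_abs_H4_le`.  THIS MODULE INTEGRATES IT: for any family of atoms
`A k` satisfying the key-quantity bounds `KeyBounds r` at every `k` of the cube with `D̂(k) < 1` (which is what
`NobleLaplacianBounds.keyBounds_and_split` / `NobleSimplifiedFormF3At.exists_keyBounds_and_split` deliver for `A = lapAtomsAt d …` below `p_c`
under `f₂ ≤ Γ₂`), and `d ≥ 2n + 5` (integrability of `Ĉ^{n+2}` on the cube, Heydenreich–van der Hofstad Prop. 5.5 via `integrable_srwK_integrand`),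

  `|∫ Ĥ₄ Ĝⁿ D̂^l D̂^{(x)} dk/(2π)^d| ≤ ∫ |Ĝ|ⁿ |Ĥ₄| |D̂|^l |D̂^{(x)}| dk/(2π)^d ≤ K̲ Γ₂′ⁿ (β_{ΔR,Φ} K_{n+1,l}(x) + β_{|ΔR,F|} Γ₂′ K_{n+2,l}(x))`

with `K_{m,l}(x) = srwK d m l x` ((3.36)) — i.e. `≤ F3Bounds.boundH4D75 τ n l x r` for every table `τ` whose `K`-entries ARE the SRW integrals
(`abs_integral_H4_diagram_le_boundH4D75`).  The two steps are integral monotonicity against the integrable majorant (the left integrand need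
not be shown integrable: `integral_mono_of_nonneg`) and linearity; `{D̂ = 1} ∩ cube = {0}` is null (`ae_Chat_mul_one_sub_Dhat`).
This is the (S2b)-IMPR leaf "H₄ ≤ its summand" (LEMMAS (I3) L3–L7, i = 4) in the D75 form that Cert rev 8's cells `D11.bo8` discharge
numerically; the print-faithful (3.78) is NOT derived here (nor, per D75, derivable from (3.46)).  `F3Bounds`, the record files and every
existing module are untouched.
[cite: FitznerVanDerHofstad2016NoBLE, §3.3.5 Step 4 (3.78) p. 1077 with (3.58) p. 1074, §3.3.4 (3.36) p. 1071 and (3.46)–(3.47) p. 1072, App. C;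
 HeydenreichVanDerHofstad2017, Prop. 5.5]
-/

noncomputable section

open MeasureTheory Real
open Literature.Barriers.CriticalPhenomena
open Literature.Barriers.CriticalPhenomena.Slade2006Prop53 (P)
open Literature.Probability.LatticeModels

namespace Literature.Probability.FitznerVanDerHofstad2017

variable {d : ℕ}

/-- Almost every point of the cube (product Lebesgue measure `P d`) lies in the cube and has `D̂(k) < 1`
(the exceptional set `{k : D̂(k) = 1} ∩ [−π,π]^d = {0}` is null; `d ≥ 1`). [folklore] -/
theorem ae_mem_cube_and_Dhat_lt_one (hd : 1 ≤ d) : ∀ᵐ k ∂P d, k ∈ cube d ∧ Dhat d k < 1 := by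
  have hcube : ∀ᵐ k ∂P d, k ∈ cube d := by
    rw [← Slade2006Prop53.volume_restrict_cube]
    exact ae_restrict_mem (MeasurableSet.univ_pi fun _ => measurableSet_Icc)
  filter_upwards [hcube, ae_Chat_mul_one_sub_Dhat hd] with k hk h1
  refine ⟨hk, lt_of_le_of_ne (Dhat_le_one k) fun h => ?_⟩
  rw [h, sub_self, mul_zero] at h1
  exact zero_ne_one h1

/-- **Step 4 integrated, absolute form** (App.-C-consistent, DIVERGENCE D75).  For atoms `A k` obeying the key-quantity bounds
`KeyBounds r` at every `k ∈ [−π,π]^d` with `D̂(k) < 1` and carrying `D = D̂(k)`, and `d ≥ 2n + 5`: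
`∫ |Ĝ|ⁿ |Ĥ₄| |D̂|^l |D̂^{(x)}| dk/(2π)^d ≤ K̲ Γ₂′ⁿ (β_{ΔR,Φ} K_{n+1,l}(x) + β_{|ΔR,F|} Γ₂′ K_{n+2,l}(x))`, `K_{m,l} = srwK d m l`.
[cite: FitznerVanDerHofstad2016NoBLE, §3.3.5 Step 4 p. 1077 (App.-C-consistent form) with §3.3.4 (3.36), (3.46)–(3.47) pp. 1071–1072] -/
theorem integral_pow_abs_G_mul_abs_H4_weight_le {n : ℕ} (hd : 2 * (n + 2) + 1 ≤ d)
    {A : (Fin d → ℝ) → LapAtoms} {r : F3Bounds.Args}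
    (hA : ∀ k ∈ cube d, Dhat d k < 1 → (A k).KeyBounds r) (hAD : ∀ k, (A k).D = Dhat d k)
    (l : ℕ) (x : Fin d → ℤ) :
    (∫ k, |(A k).G| ^ n * |(A k).H4| * (|Dhat d k| ^ l * |DhatSym d x k|) ∂P d) / (2 * π) ^ d ≤
      r.Kunderline * r.Gamma2dash ^ n *
        (r.bRpDelta * srwK d (n + 1) l x + r.bRfDelta * r.Gamma2dash * srwK d (n + 2) l x) := by
  have hI1 := integrable_srwK_integrand (d := d) (n := n + 1) (by omega) l x
  have hI2 := integrable_srwK_integrand (d := d) (n := n + 2) (by omega) l x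
  -- the integrable majorant
  set g : (Fin d → ℝ) → ℝ := fun k => r.Kunderline * r.Gamma2dash ^ n *
      (r.bRpDelta * ((|Dhat d k| ^ l * |DhatSym d x k|) * Chat d 1 k ^ (n + 1)) +
        r.bRfDelta * r.Gamma2dash * ((|Dhat d k| ^ l * |DhatSym d x k|) * Chat d 1 k ^ (n + 2))) with hg
  have hgi : Integrable g (P d) :=
    ((hI1.const_mul r.bRpDelta).add (hI2.const_mul (r.bRfDelta * r.Gamma2dash))).const_mul _
  have hle : (∫ k, |(A k).G| ^ n * |(A k).H4| * (|Dhat d k| ^ l * |DhatSym d x k|) ∂P d) ≤ ∫ k, g k ∂P d := by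
    refine integral_mono_of_nonneg (ae_of_all _ fun k => ?_) hgi ?_
    · exact mul_nonneg (mul_nonneg (pow_nonneg (abs_nonneg _) n) (abs_nonneg _))
        (mul_nonneg (pow_nonneg (abs_nonneg _) l) (abs_nonneg _))
    · filter_upwards [ae_mem_cube_and_Dhat_lt_one (d := d) (by omega)] with k hk
      have hb := (hA k hk.1 hk.2).pow_abs_G_mul_abs_H4_le n
      have hC : 1 / (1 - (A k).D) = Chat d 1 k := by rw [hAD, Chat, one_mul]
      rw [hC] at hb
      have hw : 0 ≤ |Dhat d k| ^ l * |DhatSym d x k| := mul_nonneg (pow_nonneg (abs_nonneg _) l) (abs_nonneg _)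
      calc |(A k).G| ^ n * |(A k).H4| * (|Dhat d k| ^ l * |DhatSym d x k|)
          ≤ r.Kunderline * r.Gamma2dash ^ n * (r.bRpDelta * Chat d 1 k ^ (n + 1) +
              r.bRfDelta * r.Gamma2dash * Chat d 1 k ^ (n + 2)) * (|Dhat d k| ^ l * |DhatSym d x k|) :=
            mul_le_mul_of_nonneg_right hb hw
        _ = g k := by simp only [hg]; ring
  have e1 : ∫ k, (|Dhat d k| ^ l * |DhatSym d x k|) * Chat d 1 k ^ (n + 1) ∂P d =
      (2 * π) ^ d * srwK d (n + 1) l x := by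
    unfold srwK; field_simp
  have e2 : ∫ k, (|Dhat d k| ^ l * |DhatSym d x k|) * Chat d 1 k ^ (n + 2) ∂P d =
      (2 * π) ^ d * srwK d (n + 2) l x := by
    unfold srwK; field_simp
  have hint : ∫ k, g k ∂P d = (2 * π) ^ d * (r.Kunderline * r.Gamma2dash ^ n *
      (r.bRpDelta * srwK d (n + 1) l x + r.bRfDelta * r.Gamma2dash * srwK d (n + 2) l x)) := by
    simp only [hg]
    rw [integral_const_mul, integral_add (hI1.const_mul _) (hI2.const_mul _), integral_const_mul,
      integral_const_mul, e1, e2]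
    ring
  rw [div_le_iff₀ (two_pi_pow_pos d)]
  calc (∫ k, |(A k).G| ^ n * |(A k).H4| * (|Dhat d k| ^ l * |DhatSym d x k|) ∂P d)
      ≤ ∫ k, g k ∂P d := hle
    _ = _ := by rw [hint]; ring

/-- **Step 4 integrated, for the signed diagram integrand (3.58)**: under the same hypotheses,
`|∫ Ĥ₄ Ĝⁿ D̂^l D̂^{(x)} dk/(2π)^d| ≤ K̲ Γ₂′ⁿ (β_{ΔR,Φ} K_{n+1,l}(x) + β_{|ΔR,F|} Γ₂′ K_{n+2,l}(x))`.
[cite: FitznerVanDerHofstad2016NoBLE, §3.3.5 (3.58) p. 1074 and Step 4 p. 1077 (App.-C-consistent form)] -/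
theorem abs_integral_H4_diagram_le {n : ℕ} (hd : 2 * (n + 2) + 1 ≤ d)
    {A : (Fin d → ℝ) → LapAtoms} {r : F3Bounds.Args}
    (hA : ∀ k ∈ cube d, Dhat d k < 1 → (A k).KeyBounds r) (hAD : ∀ k, (A k).D = Dhat d k)
    (l : ℕ) (x : Fin d → ℤ) :
    |(∫ k, (A k).H4 * (A k).G ^ n * Dhat d k ^ l * DhatSym d x k ∂P d) / (2 * π) ^ d| ≤
      r.Kunderline * r.Gamma2dash ^ n *
        (r.bRpDelta * srwK d (n + 1) l x + r.bRfDelta * r.Gamma2dash * srwK d (n + 2) l x) := by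
  rw [abs_div, abs_of_pos (two_pi_pow_pos d)]
  refine le_trans (div_le_div_of_nonneg_right abs_integral_le_integral_abs (two_pi_pow_pos d).le) ?_
  have heq : (fun k => |(A k).H4 * (A k).G ^ n * Dhat d k ^ l * DhatSym d x k|) =
      fun k => |(A k).G| ^ n * |(A k).H4| * (|Dhat d k| ^ l * |DhatSym d x k|) := by
    funext k; simp only [abs_mul, abs_pow]; ring
  rw [heq]
  exact integral_pow_abs_G_mul_abs_H4_weight_le hd hA hAD l x

/-- **Tables form**: for a table `τ` whose `K`-entries are the SRW integrals `K_{m,l}(x) = srwK d m l x` ((3.36)), the bound IS the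
App.-C-consistent Step-4 summand `F3Bounds.boundH4D75 τ n l x r` of `F3BoundsD75`.
[cite: FitznerVanDerHofstad2016NoBLE, §3.3.5 Step 4 (3.78) p. 1077, App.-C-consistent form; §3.3.4 (3.36) p. 1071] -/
theorem abs_integral_H4_diagram_le_boundH4D75 {n : ℕ} (hd : 2 * (n + 2) + 1 ≤ d)
    {A : (Fin d → ℝ) → LapAtoms} {r : F3Bounds.Args}
    (hA : ∀ k ∈ cube d, Dhat d k < 1 → (A k).KeyBounds r) (hAD : ∀ k, (A k).D = Dhat d k)
    (τ : F3Bounds.Tables (Fin d → ℤ)) (hK : ∀ m l x, τ.K m l x = srwK d m l x) (l : ℕ) (x : Fin d → ℤ) :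
    |(∫ k, (A k).H4 * (A k).G ^ n * Dhat d k ^ l * DhatSym d x k ∂P d) / (2 * π) ^ d| ≤
      F3Bounds.boundH4D75 τ n l x r := by
  rw [F3Bounds.boundH4D75, hK, hK]
  exact abs_integral_H4_diagram_le hd hA hAD l x

/-- **The atoms of `NobleLaplacianSplit`**: with `A = lapAtomsAt d c_Φ α_Φ c_F α_F R_Φ R_F` (whose `D`-field is `D̂(k)` by construction) the
hypothesis is exactly the `KeyBounds` conjunct delivered by `keyBounds_and_split` / `NobleSimplifiedFormF3At.exists_keyBounds_and_split`
(below `p_c`, `f₂(p) ≤ Γ₂`, `0 < α̲_F`, `β_Δ < α̲_F`), under which also `τ̂_p = Ĝ` — so the integrand is (3.58)'s `Ĥ₄ D̂^l τ̂_pⁿ D̂^{(x)}`.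
[cite: FitznerVanDerHofstad2016NoBLE, §3.3.5 (3.58) p. 1074, Step 4 p. 1077 (App.-C-consistent form); §3.3.4 (3.40)–(3.57) pp. 1072–1074] -/
theorem abs_integral_H4_diagram_le_boundH4D75_lapAtomsAt {n : ℕ} (hd : 2 * (n + 2) + 1 ≤ d)
    {cΦ αΦ cF αF : ℝ} {RΦ RF : Site d → ℝ} {r : F3Bounds.Args}
    (hKB : ∀ k ∈ cube d, Dhat d k < 1 → (lapAtomsAt d cΦ αΦ cF αF RΦ RF k).KeyBounds r)
    (τ : F3Bounds.Tables (Fin d → ℤ)) (hK : ∀ m l x, τ.K m l x = srwK d m l x) (l : ℕ) (x : Fin d → ℤ) :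
    |(∫ k, (lapAtomsAt d cΦ αΦ cF αF RΦ RF k).H4 * (lapAtomsAt d cΦ αΦ cF αF RΦ RF k).G ^ n *
        Dhat d k ^ l * DhatSym d x k ∂P d) / (2 * π) ^ d| ≤
      F3Bounds.boundH4D75 τ n l x r :=
  abs_integral_H4_diagram_le_boundH4D75 hd hKB (fun _ => rfl) τ hK l x

end Literature.Probability.FitznerVanDerHofstad2017

end
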